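import Literature.Analysis.FluidPDE.KNSSTypeIRateMild
import Literature.Analysis.FluidPDE.KNSSMildDecay
import Literature.Analysis.FluidPDE.KNSSTypeIRateVertexProofs
import Literature.Analysis.FluidPDE.KNSSTypeIRateCoreProofs
import Literature.Analysis.UnboundedOperators.HeatKernelBoundedData
import HarnessLib

/-!
# KNSS 2009, Theorem 6.2: the two mildness facts of the tree agree, and the main step from
# Theorem 6.1's mildness clause, compactness and the Liouville step (proved)

Analysis/FluidPDE proof file (everything proved; no definitions, no named facts) for the
decomposition of `Literature.Analysis.FluidPDE.KNSS2009_typeI_rate_rMulNorm_bounded`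
(Koch–Nadirashvili–Seregin–Šverák, Acta Math. 203 (2009) = arXiv:0709.3599, Theorem 6.2, main
step). The tree now carries two renderings of the printed mildness clause ("(6.4) implies that
`u` is a mild solution", p. 12; proof of Theorem 6.1, last paragraph):

* `KNSS2009_mild_of_rMulNorm_bounded` (`KNSSMildDecay`): window form, `ν = 1`, decay
  `|x'|‖u‖ ≤ D` on the whole sub-slab `(a, T] × ℝ³`;
* `KNSS2009_typeI_rate_mild` (`KNSSTypeIRateMild`): the hypotheses of Theorem 6.2 — classical on
  `(0, T)` with viscosity `ν > 0`, bounded on the sub-slabs, (assumption2) = (6.4)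
  `|x'|‖u‖ ≤ C` for `|x'| ≥ R₀`.

This file **proves** that the first implies the second
(`KNSS2009_typeI_rate_mild_of_mild_of_rMulNorm_bounded`): on `(0, t] × ℝ³`, `t < T`, a field
bounded by `M` with (6.4) satisfies `|x'|‖u‖ ≤ max C (R₀ M)`, and the viscosity is normalised by
the time dilation `ũ(s, x) = ν⁻¹u(s/ν, x)` (`timeRescale`, `NSViscosityRescaling`), under which
the Oseen equation with viscosity `ν` for `u` is the Oseen equation with viscosity `1` for `ũ`
(`oseenDuhamel_one_timeRescale`: substitute `ρ = νρ'` in the time integral). Hence the third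
layer of the decomposition (`KNSSTypeIRateMild`, `KNSSTypeIRateMildProofs`) rests on the single
mildness fact `KNSS2009_mild_of_rMulNorm_bounded`, shared with the vertex estimate
(`KNSS2009_typeI_rate_vertex_of_mild`, `KNSSTypeIRateVertexProofs`). With the latter, the gen-0
assembly gives the main step of Theorem 6.2 from the mildness clause, the compactness ingredient
and the Liouville step:

* `KNSS2009_typeI_rate_rMulNorm_bounded_of_mild_compactness_liouville :
    KNSS2009_mild_of_rMulNorm_bounded → KNSS2009_typeI_rate_compactness →
    KNSS2009_typeI_rate_liouville → KNSS2009_typeI_rate_rMulNorm_bounded`.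

## References

* G. Koch, N. Nadirashvili, G. Seregin, V. Šverák, Acta Math. 203 (2009) 83–105 =
  arXiv:0709.3599: Theorem 6.2 and its proof, pp. 12–13; Theorem 6.1, proof, last paragraph,
  p. 12; §1 (1.1) (the normalisation `ν = 1`). [KochNadirashviliSereginSverak2009]
-/

noncomputable section

open MeasureTheory Set Function Filter
open _root_.Topology

namespace Literature.Analysis.FluidPDE

/-! ### The Oseen equation under the viscosity normalisation `ũ(s) = ν⁻¹ u(s/ν)` -/

section Viscosity

variable {E : Type*} [NormedAddCommGroup E] [InnerProductSpace ℝ E] [FiniteDimensional ℝ E]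
  [MeasurableSpace E] [BorelSpace E]

/-- Time substitution `ρ = νρ'` in an integral over `(νs, νt)`:
`∫_{(νs, νt)} g(ν⁻¹ρ) dρ = ν ∫_{(s, t)} g(ρ') dρ'` (`ν > 0`, `s ≤ t`). [folklore] -/
theorem setIntegral_Ioo_mul_mul_comp_inv_mul {G : Type*} [NormedAddCommGroup G] [NormedSpace ℝ G]
    (g : ℝ → G) {ν : ℝ} (hν : 0 < ν) {s t : ℝ} (hst : s ≤ t) :
    ∫ ρ in Ioo (ν * s) (ν * t), g (ν⁻¹ * ρ) = ν • ∫ ρ in Ioo s t, g ρ := by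
  have hle : ν * s ≤ ν * t := mul_le_mul_of_nonneg_left hst hν.le
  have key := intervalIntegral.integral_comp_mul_left (fun ρ => g ρ) (a := ν * s) (b := ν * t)
    (inv_ne_zero hν.ne')
  rw [inv_inv, show ν⁻¹ * (ν * s) = s by field_simp, show ν⁻¹ * (ν * t) = t by field_simp] at key
  rw [← integral_Ioc_eq_integral_Ioo, ← intervalIntegral.integral_of_le hle,
    ← integral_Ioc_eq_integral_Ioo, ← intervalIntegral.integral_of_le hst, key]

/-- **The Duhamel term under the viscosity normalisation**: for `ũ = timeRescale ν⁻¹ ν⁻¹ u`,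
i.e. `ũ(s, x) = ν⁻¹ u(s/ν, x)`, and `s ≤ t`,
`B¹_{νs}(ũ, ũ)(νt)(x) = ν⁻¹ B^ν_s(u, u)(t)(x)` (bilinearity and `ρ = νρ'`; KNSS 2009, §1 (1.1):
`ν = 1` by rescaling; Tao 2011, footnote 3). [cite: KochNadirashviliSereginSverak2009, §1 (1.1) (arXiv p. 2)] -/
theorem oseenDuhamel_one_timeRescale {ν : ℝ} (hν : 0 < ν) (u : ℝ → E → E) {s t : ℝ} (hst : s ≤ t)
    (x : E) :
    oseenDuhamel 1 (ν * s) (timeRescale ν⁻¹ ν⁻¹ u) (timeRescale ν⁻¹ ν⁻¹ u) (ν * t) x =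
      ν⁻¹ • oseenDuhamel ν s u u t x := by
  have hν0 : ν ≠ 0 := hν.ne'
  rw [oseenDuhamel_apply, oseenDuhamel_apply]
  have e : ∀ ρ, ∫ y, oseenKernel (1 * (ν * t - ρ)) (x - y) (timeRescale ν⁻¹ ν⁻¹ u ρ y)
      (timeRescale ν⁻¹ ν⁻¹ u ρ y) =
      (fun ρ' => (ν⁻¹ * ν⁻¹) • ∫ y, oseenKernel (ν * (t - ρ')) (x - y) (u ρ' y) (u ρ' y)) (ν⁻¹ * ρ) := by
    intro ρ
    simp only [timeRescale_apply, oseenKernel_smul_left, oseenKernel_smul_right, smul_smul,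
      integral_smul, one_mul]
    congr 2
    funext y
    rw [show ν * (t - ν⁻¹ * ρ) = ν * t - ρ by field_simp]
  rw [setIntegral_congr_fun measurableSet_Ioo (fun ρ _ => e ρ),
    setIntegral_Ioo_mul_mul_comp_inv_mul
      (fun ρ' => (ν⁻¹ * ν⁻¹) • ∫ y, oseenKernel (ν * (t - ρ')) (x - y) (u ρ' y) (u ρ' y)) hν hst,
    integral_smul, smul_smul]
  congr 1
  field_simp

/-- **The Oseen equation is invariant under the viscosity normalisation**: if
`ũ = timeRescale ν⁻¹ ν⁻¹ u` satisfies `ũ(νt) = e^{(νt−νs)Δ}ũ(νs) − B¹_{νs}(ũ, ũ)(νt)` at `x`, then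
`u(t) = e^{ν(t−s)Δ}u(s) − B^ν_s(u, u)(t)` at `x` (`s ≤ t`, `ν > 0`). [cite: KochNadirashviliSereginSverak2009, §1 (1.1) (arXiv p. 2)] -/
theorem oseen_of_oseen_timeRescale {ν : ℝ} (hν : 0 < ν) {u : ℝ → E → E} {s t : ℝ} (hst : s ≤ t)
    {x : E}
    (h : timeRescale ν⁻¹ ν⁻¹ u (ν * t) x =
      UnboundedOperators.heatExtension (timeRescale ν⁻¹ ν⁻¹ u (ν * s)) (ν * t - ν * s) x -
        oseenDuhamel 1 (ν * s) (timeRescale ν⁻¹ ν⁻¹ u) (timeRescale ν⁻¹ ν⁻¹ u) (ν * t) x) :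
    u t x = UnboundedOperators.heatExtension (u s) (ν * (t - s)) x - oseenDuhamel ν s u u t x := by
  have hν0 : ν ≠ 0 := hν.ne'
  rw [oseenDuhamel_one_timeRescale hν u hst x, timeRescale_apply, timeRescale_slice,
    UnboundedOperators.heatExtension_const_smul, show ν⁻¹ * (ν * t) = t by field_simp,
    show ν⁻¹ * (ν * s) = s by field_simp, show ν * t - ν * s = ν * (t - s) by ring, ← smul_sub] at h
  have h' := congrArg (fun v => ν • v) h
  simp only [smul_smul, mul_inv_cancel₀ hν0, one_smul] at h'
  exact h'

end Viscosity

/-! ### The Type I mildness fact from Theorem 6.1's mildness clause -/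

/-- **`KNSS2009_mild_of_rMulNorm_bounded → KNSS2009_typeI_rate_mild`**: under the hypotheses
of Theorem 6.2 (classical on `(0, T)`, bounded on the sub-slabs, (6.4) for `|x'| ≥ R₀`), on each
`(0, t] × ℝ³`, `t < T`, the field satisfies `|x'|‖u‖ ≤ max C (R₀M)`, so the mildness clause of
Theorem 6.1 (window form, `ν = 1`, applied to the normalised field `ν⁻¹u(s/ν, x)` on
`(0, νT)`, `IsClassicalNSSolutionOn.viscosityRescale_set`) yields the Oseen equation with
viscosity `ν` between all `0 < s < t < T` (`oseen_of_oseen_timeRescale`). This is the printed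
sentence "We have seen in the proof of Theorem 6.1 that (6.4) implies that `u` is a mild
solution" (arXiv p. 12). [cite: KochNadirashviliSereginSverak2009, proof of Thm 6.2, first sentence (arXiv p. 12)] -/
theorem KNSS2009_typeI_rate_mild_of_mild_of_rMulNorm_bounded
    (hm : KNSS2009_mild_of_rMulNorm_bounded) : KNSS2009_typeI_rate_mild := by
  intro ν T u p hν hT h hbdd hdecay s t hs hst htT x
  obtain ⟨C, R₀, hR₀, hC⟩ := hdecay
  -- the normalised solution with unit viscosity on `(0, νT)`
  have hmaps : MapsTo (fun r => ν⁻¹ * r) (Ioo 0 (ν * T)) (Ioo 0 T) :=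
    fun r hr => (inv_mul_mem_Ioo_iff hν).2 hr
  have h1 : IsClassicalNSSolutionOn (Ioo 0 (ν * T)) 1 0 (timeRescale ν⁻¹ ν⁻¹ u)
      (timeRescale ν⁻¹ (ν⁻¹ ^ 2) p) := by
    simpa using h.viscosityRescale_set hν.ne' hmaps isOpen_Ioo.uniqueDiffOn
  have hinv : 0 ≤ ν⁻¹ := inv_nonneg.2 hν.le
  -- bounds on `(0, νt] × ℝ³`
  have hT' : (t + T) / 2 < T := by linarith
  obtain ⟨M, hM⟩ := hbdd _ hT'
  have hmem : ∀ r ∈ Ioc 0 (ν * t), ν⁻¹ * r ∈ Ioo 0 ((t + T) / 2) := by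
    intro r hr
    refine ⟨mul_pos (inv_pos.2 hν) hr.1, ?_⟩
    have : ν⁻¹ * r ≤ t := by
      calc ν⁻¹ * r ≤ ν⁻¹ * (ν * t) := mul_le_mul_of_nonneg_left hr.2 hinv
        _ = t := by field_simp
    linarith
  have hmemT : ∀ r ∈ Ioc 0 (ν * t), ν⁻¹ * r ∈ Ioo 0 T := fun r hr =>
    ⟨(hmem r hr).1, (hmem r hr).2.trans hT'⟩
  have hL : ∃ L : ℝ, ∀ r ∈ Ioc 0 (ν * t), ∀ y, ‖timeRescale ν⁻¹ ν⁻¹ u r y‖ ≤ L := by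
    refine ⟨ν⁻¹ * M, fun r hr y => ?_⟩
    rw [timeRescale_apply, norm_smul, Real.norm_of_nonneg hinv]
    exact mul_le_mul_of_nonneg_left (hM _ (hmem r hr) y) hinv
  have hD : ∃ D : ℝ, ∀ r ∈ Ioc 0 (ν * t), ∀ y,
      cylRadius y * ‖timeRescale ν⁻¹ ν⁻¹ u r y‖ ≤ D := by
    refine ⟨ν⁻¹ * max C (R₀ * M), fun r hr y => ?_⟩
    rw [timeRescale_apply, norm_smul, Real.norm_of_nonneg hinv]
    have hprod : cylRadius y * ‖u (ν⁻¹ * r) y‖ ≤ max C (R₀ * M) := by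
      rcases le_or_gt R₀ (cylRadius y) with hy | hy
      · exact (hC _ (hmemT r hr) y hy).trans (le_max_left _ _)
      · have h0 : 0 ≤ cylRadius y := by unfold cylRadius; positivity
        have hM0 : 0 ≤ M := (norm_nonneg _).trans (hM _ (hmem r hr) y)
        calc cylRadius y * ‖u (ν⁻¹ * r) y‖ ≤ R₀ * M :=
              mul_le_mul hy.le (hM _ (hmem r hr) y) (norm_nonneg _) hR₀.le
          _ ≤ max C (R₀ * M) := le_max_right _ _
    calc cylRadius y * (ν⁻¹ * ‖u (ν⁻¹ * r) y‖) = ν⁻¹ * (cylRadius y * ‖u (ν⁻¹ * r) y‖) := by ring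
      _ ≤ ν⁻¹ * max C (R₀ * M) := mul_le_mul_of_nonneg_left hprod hinv
  -- the mildness clause of Theorem 6.1 for the normalised field on `(0, νt]`
  have key := hm h1 (mul_pos hν (hs.trans hst)) (mul_lt_mul_of_pos_left htT hν) hL hD
    (s := ν * s) (t := ν * t) (mul_pos hν hs) (mul_lt_mul_of_pos_left hst hν) le_rfl x
  exact oseen_of_oseen_timeRescale hν hst.le key

/-! ### The main step of Theorem 6.2 from the mildness clause, compactness and Liouville -/

/-- **KNSS 2009, Theorem 6.2, main step, from Theorem 6.1's mildness clause, the compactness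
ingredient and the Liouville step**: the vertex ingredient being discharged from the mildness
clause (`KNSS2009_typeI_rate_vertex_of_mild`, `KNSSTypeIRateVertexProofs`), the gen-0 assembly
`KNSS2009_typeI_rate_rMulNorm_bounded_of_blowupSequence ∘ KNSS2009_typeI_rate_blowupSequence_of_core`
leaves the mildness clause, compactness (Lemma 6.1) and the Liouville step (Theorem 5.1 with
Remark 6.1) as hypotheses. [cite: KochNadirashviliSereginSverak2009, Thm 6.2 and its proof (arXiv pp. 12–13)] -/
theorem KNSS2009_typeI_rate_rMulNorm_bounded_of_mild_compactness_liouville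
    (hm : KNSS2009_mild_of_rMulNorm_bounded) (h1 : KNSS2009_typeI_rate_compactness)
    (h2 : KNSS2009_typeI_rate_liouville) : KNSS2009_typeI_rate_rMulNorm_bounded :=
  KNSS2009_typeI_rate_rMulNorm_bounded_of_blowupSequence
    (KNSS2009_typeI_rate_blowupSequence_of_core h1 h2 (KNSS2009_typeI_rate_vertex_of_mild hm))

/-- **KNSS 2009, Theorem 6.2 as vendored, from Theorem 6.1 (with its mildness clause), the
compactness ingredient and the Liouville step.** [cite: KochNadirashviliSereginSverak2009, Thm 6.2 and its proof (arXiv pp. 12–13)] -/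
theorem KNSS2009_regularity_typeI_rate_of_mild_compactness_liouville
    (h61 : KNSS2009_regularity_bound_C_over_r) (hm : KNSS2009_mild_of_rMulNorm_bounded)
    (h1 : KNSS2009_typeI_rate_compactness) (h2 : KNSS2009_typeI_rate_liouville) :
    KNSS2009_regularity_typeI_rate :=
  KNSS2009_regularity_typeI_rate_of_parts h61
    (KNSS2009_typeI_rate_rMulNorm_bounded_of_mild_compactness_liouville hm h1 h2)

end Literature.Analysis.FluidPDE

end
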